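import Literature.NumberTheory.ComplexMultiplication.GaloisCMFieldsTwiceOddDegreePair
import Literature.AlgebraicGeometry.Pohlmann1968.SeparatingCMFamilies
import Summits.HodgeConjecture.CorCM.RealIntersectionCMFieldsHodge
import HarnessLib

/-!
# Two CM abelian varieties with GALOIS CM fields of degree `≡ 2 (mod 4)`: `B• = D•` on every `A₀^a × A₁^b` iff
# `[L₀ ∩ L₁ : ℚ]` is odd and the types are nondegenerate; an exceptional Hodge class iff it is even or a type is degenerate

COR-CM (cell `pub-hodgecm2`, binder seat `b23` gen 28), count-neutral; NEW as stated, hence under `Summits/`.  The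
geometric face of `Literature.NumberTheory.ComplexMultiplication.GaloisCMFieldsTwiceOddDegreePair` (this seat; it
supersedes `Summits/HodgeConjecture/CorCM/PrimeDegreeCMFieldPairsHodge`, the case of prime half-degree): `K_{i₀}`, `K_{i₁}`
Galois CM fields of degrees `2m₀`, `2m₁` with `m₀`, `m₁` ODD (`ℚ(ζ_p)`, `p ≡ 3 (mod 4)`; cyclic sextics; …), NO hypothesis
`L₀ ≠ L₁`, `d = [L₀ ∩ L₁ : ℚ]` (`L_i = normalClosure ℚ K_i ℂ`); realisations `(A_i, ι_i, θ_i)` of CM types `Φ_i` on `H¹`: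

* **`isNondegenerateFamily_iff_of_twice_odd`** — `IsNondegenerateFamily Φ ⟺ d odd ∧ every Φ_i nondegenerate`
  (`rank Hg(A₀ × A₁) = dim A₀ + dim A₁ + 1 ⟺ …`), for ALL types, with no separation hypothesis;
* **`hodgeConjectureFor_prod_pair_of_twice_odd_of_odd_finrank_inf`** — `d` odd, nondegenerate types: the Hodge
  conjecture on every `⨁_{j<N} A_{π j}` (every `A₀^a × A₁^b`), with `B• = D•` there;
* **`forall_prod_hodgeClassSpan_eq_iff_of_twice_odd`** — separating family (simple, pairwise non-isogenous factors):
  `B• = D•` on EVERY product ⟺ `d` odd ∧ every `Φ_i` nondegenerate;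
* **`exists_exceptional_prod_iff_of_twice_odd`** — separating family: SOME product carries a rational `(m,m)`-class
  outside `Dᵐ ⊗ ℂ` ⟺ `d` even ∨ some `Φ_i` degenerate; in particular (`exists_exceptional_prod_pair_of_twice_odd_of_even_finrank_inf`)
  `d` even FORCES an exceptional class (a Weil class of the shared imaginary quadratic field), whatever the types;
* **`hodgeConjectureFor_prod_or_exists_exceptional_of_isSimple_of_twice_odd`** — the packaged dichotomy for two simple,
  non-isogenous `A_{i₀}`, `A_{i₁}` with nondegenerate types.

Examples (`m = 3, 5, 9, …`): `ℚ(ζ_7) × ℚ(ζ_{11})` (`d = 1`), `ℚ(ζ_7) × ℚ(√−3)·ℚ(ζ_7)⁺` (`d = 3`): Hodge conjecture on all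
`A₀^a × A₁^b` for nondegenerate (e.g. primitive, by Yanai in prime half-degree) types; `ℚ(ζ_7) × ℚ(√−7)·C` for any cyclic
`C` of odd degree (`d` even): exceptional classes forced.  Theorems only, no definition, no `sorry`.

## References

* [Gordon1999HodgeAVSurvey] B. B. Gordon, *A survey of the Hodge conjecture for abelian varieties*, §3 Theorem (proof),
  7.4–7.7, 7.6.1, 10.10.
* [Rotman1995] J. J. Rotman, *An Introduction to the Theory of Groups*, 4th ed., GTM 148, Thm. 7.41 (Schur–Zassenhaus).
* [Deligne1982HodgeCycles] P. Deligne, *Hodge cycles on abelian varieties*, LNM 900 (1982), §4 (Weil classes).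
-/

noncomputable section

open CategoryTheory CategoryTheory.Limits NumberField IntermediateField Module

namespace Summit.HodgeConjecture.CorCM

open Literature.NumberTheory.ComplexMultiplication
open Literature.AlgebraicGeometry.Motives (AbelianVariety CMType)
open Literature.AlgebraicGeometry.HodgeTheory
open Literature.AlgebraicGeometry.ComplexMultiplication (IsCMTypeRealisation)
open Literature.AlgebraicGeometry.VanGeemen1994 (hodgeClassSpan)
open Literature.AlgebraicGeometry.Pohlmann1968
open Literature.Barriers.HodgeConjecture (divisorClassesSpan)

/-! ### Types: the deciding invariant is the parity of `[L₀ ∩ L₁ : ℚ]` -/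

section Types

variable {I : Type} {K : I → Type} [∀ i, Field (K i)] [∀ i, NumberField (K i)] [∀ i, IsCMField (K i)] [Fintype I]
  [Nonempty I] {Φ : ∀ i, CMType (K i)}

/-- **The deciding invariant.**  For two Galois CM fields of degrees `2m₀`, `2m₁` (`m₀`, `m₁` odd) and ANY types: the
family `(Φ_{i₀}, Φ_{i₁})` is nondegenerate iff `[L₀ ∩ L₁ : ℚ]` is ODD and both members are nondegenerate — `d` odd
gives partial conjugations (nondegenerate iff the members are), `d` even a shared imaginary quadratic field (always
degenerate), and members of a nondegenerate family are nondegenerate (7.6.1).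
[cite: Gordon1999HodgeAVSurvey, §3 Theorem, 7.5–7.7 and 7.6.1] [cite: Rotman1995, Thm. 7.41] -/
theorem isNondegenerateFamily_iff_of_twice_odd {m₀ m₁ : ℕ} (hm₀ : Odd m₀) (hm₁ : Odd m₁) {i₀ i₁ : I}
    (h01 : i₀ ≠ i₁) (hI : ∀ j, j = i₀ ∨ j = i₁) [IsGalois ℚ (K i₀)] [IsGalois ℚ (K i₁)]
    (h₀ : finrank ℚ (K i₀) = 2 * m₀) (h₁ : finrank ℚ (K i₁) = 2 * m₁) :
    CMAlgebra.IsNondegenerateFamily Φ ↔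
      Odd (finrank ℚ ↥(normalClosure ℚ (K i₀) ℂ ⊓ normalClosure ℚ (K i₁) ℂ)) ∧ ∀ i, IsNondegenerate (Φ i) := by
  refine ⟨fun hnd => ⟨?_, fun i => hnd.isNondegenerate i⟩, fun h => ?_⟩
  · rcases Nat.even_or_odd (finrank ℚ ↥(normalClosure ℚ (K i₀) ℂ ⊓ normalClosure ℚ (K i₁) ℂ)) with hev | hodd
    · exact absurd hnd (not_isNondegenerateFamily_of_twice_odd_of_even_finrank_inf hm₀ hm₁ h01 h₀ h₁ hev Φ)
    · exact hodd
  · exact (isNondegenerateFamily_iff_of_partialConj (forall_exists_partialConj_pair_of_odd_finrank h01 hI h.1) Φ).2 h.2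

/-- **Nondegenerate types: the family is nondegenerate iff `[L₀ ∩ L₁ : ℚ]` is odd.**
[cite: Gordon1999HodgeAVSurvey, §3 Theorem and 7.5–7.7] [cite: Rotman1995, Thm. 7.41] -/
theorem isNondegenerateFamily_iff_odd_finrank_inf_of_twice_odd {m₀ m₁ : ℕ} (hm₀ : Odd m₀) (hm₁ : Odd m₁)
    {i₀ i₁ : I} (h01 : i₀ ≠ i₁) (hI : ∀ j, j = i₀ ∨ j = i₁) [IsGalois ℚ (K i₀)] [IsGalois ℚ (K i₁)]
    (h₀ : finrank ℚ (K i₀) = 2 * m₀) (h₁ : finrank ℚ (K i₁) = 2 * m₁) (hΦ : ∀ i, IsNondegenerate (Φ i)) :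
    CMAlgebra.IsNondegenerateFamily Φ ↔ Odd (finrank ℚ ↥(normalClosure ℚ (K i₀) ℂ ⊓ normalClosure ℚ (K i₁) ℂ)) := by
  rw [isNondegenerateFamily_iff_of_twice_odd hm₀ hm₁ h01 hI h₀ h₁]
  exact ⟨fun h => h.1, fun h => ⟨h, hΦ⟩⟩

end Types

/-! ### Abelian varieties -/

section Geometry

variable {I : Type} {K : I → Type} [∀ i, Field (K i)] [∀ i, NumberField (K i)] [∀ i, IsCMField (K i)] [Fintype I]
  [Nonempty I] {Φ : ∀ i, CMType (K i)}
variable {A : I → AbelianVariety ℂ} {ι : ∀ i, 𝓞 (K i) →+* End (A i)}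
  {θ : ∀ i, K i →+* Module.End ℂ (complexBetti (A i).X 1)}

/-- **`[L₀ ∩ L₁ : ℚ]` odd: the Hodge conjecture for every `A₀^a × A₁^b`** (every `⨁_{j<N} A_{π j}`) of realisations of
nondegenerate CM types of two Galois CM fields of degrees `2m₀`, `2m₁`, `m₀`, `m₁` odd — UNCONDITIONAL (partial
conjugations; this direction holds for all CM fields, `hodgeConjectureFor_prod_pair_of_odd_finrank`, and is recorded here
for the dichotomy). [cite: Gordon1999HodgeAVSurvey, §3 Theorem and 10.10] -/
theorem hodgeConjectureFor_prod_pair_of_twice_odd_of_odd_finrank_inf {i₀ i₁ : I} (h01 : i₀ ≠ i₁)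
    (hI : ∀ j, j = i₀ ∨ j = i₁) (hodd : Odd (finrank ℚ ↥(normalClosure ℚ (K i₀) ℂ ⊓ normalClosure ℚ (K i₁) ℂ)))
    (hΦ : ∀ i, IsNondegenerate (Φ i)) (hA : ∀ i, IsCMTypeRealisation (Φ i) (A i) (ι i) (θ i)) {N : ℕ}
    (π : Fin N → I) :
    HodgeConjectureFor (⨁ fun j : Fin N => A (π j)).dim (⨁ fun j : Fin N => A (π j)).X ∧
      ∀ m : ℕ, hodgeClassSpan (⨁ fun j : Fin N => A (π j)).dim (⨁ fun j : Fin N => A (π j)).X m =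
        divisorClassesSpan (⨁ fun j : Fin N => A (π j)).X (⨁ fun j : Fin N => A (π j)).dim m :=
  ⟨hodgeConjectureFor_prod_of_partialConj (forall_exists_partialConj_pair_of_odd_finrank h01 hI hodd) hΦ hA π, fun m =>
    hodgeClassSpan_prod_eq_divisorClassesSpan_of_partialConj (forall_exists_partialConj_pair_of_odd_finrank h01 hI hodd)
      hΦ hA π m⟩

/-- **`[L₀ ∩ L₁ : ℚ]` even: an exceptional Hodge class is FORCED, whatever the types.**  For a separating family
(simple, pairwise non-isogenous realisations) of two Galois CM fields of degrees `2m₀`, `2m₁` (`m₀`, `m₁` odd) whose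
closures meet in a field of even degree, some product `⨁_{j<N} A_{π j}` carries a rational `(m,m)`-class outside
`Dᵐ ⊗ ℂ` — the fields share an imaginary quadratic field of odd relative degrees and its Weil classes appear.
[cite: Gordon1999HodgeAVSurvey, 7.5] [cite: Deligne1982HodgeCycles, §4] [cite: Rotman1995, Thm. 7.41] -/
theorem exists_exceptional_prod_pair_of_twice_odd_of_even_finrank_inf {m₀ m₁ : ℕ} (hm₀ : Odd m₀) (hm₁ : Odd m₁)
    {i₀ i₁ : I} (h01 : i₀ ≠ i₁) [IsGalois ℚ (K i₀)] [IsGalois ℚ (K i₁)] (h₀ : finrank ℚ (K i₀) = 2 * m₀)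
    (h₁ : finrank ℚ (K i₁) = 2 * m₁) (hsep : CMAlgebra.IsSeparatingFamily Φ)
    (hev : Even (finrank ℚ ↥(normalClosure ℚ (K i₀) ℂ ⊓ normalClosure ℚ (K i₁) ℂ)))
    (hA : ∀ i, IsCMTypeRealisation (Φ i) (A i) (ι i) (θ i)) :
    ∃ (N : ℕ) (π : Fin N → I) (m : ℕ) (c : complexBetti (⨁ fun j : Fin N => A (π j)).X (2 * m)),
      IsRationalClass c ∧
      IsOfHodgeType (⨁ fun j : Fin N => A (π j)).dim (⨁ fun j : Fin N => A (π j)).X (2 * m) m m c ∧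
      c ∉ divisorClassesSpan (⨁ fun j : Fin N => A (π j)).X (⨁ fun j : Fin N => A (π j)).dim m :=
  CMAlgebra.exists_exceptional_prod_of_not_isNondegenerateFamily hsep
    (not_isNondegenerateFamily_of_twice_odd_of_even_finrank_inf hm₀ hm₁ h01 h₀ h₁ hev Φ) hA

/-- **`B• = D•` on every `A₀^a × A₁^b` iff `[L₀ ∩ L₁ : ℚ]` is odd and both types are nondegenerate** — for a
separating family of realisations of two Galois CM fields of degrees `2m₀`, `2m₁`, `m₀`, `m₁` odd.
[cite: Gordon1999HodgeAVSurvey, §3 Theorem, 7.5–7.7 and 7.6.1] [cite: Rotman1995, Thm. 7.41] -/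
theorem forall_prod_hodgeClassSpan_eq_iff_of_twice_odd {m₀ m₁ : ℕ} (hm₀ : Odd m₀) (hm₁ : Odd m₁) {i₀ i₁ : I}
    (h01 : i₀ ≠ i₁) (hI : ∀ j, j = i₀ ∨ j = i₁) [IsGalois ℚ (K i₀)] [IsGalois ℚ (K i₁)]
    (h₀ : finrank ℚ (K i₀) = 2 * m₀) (h₁ : finrank ℚ (K i₁) = 2 * m₁) (hsep : CMAlgebra.IsSeparatingFamily Φ)
    (hA : ∀ i, IsCMTypeRealisation (Φ i) (A i) (ι i) (θ i)) :
    (∀ (N : ℕ) (π : Fin N → I) (m : ℕ),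
        hodgeClassSpan (⨁ fun j : Fin N => A (π j)).dim (⨁ fun j : Fin N => A (π j)).X m =
          divisorClassesSpan (⨁ fun j : Fin N => A (π j)).X (⨁ fun j : Fin N => A (π j)).dim m) ↔
      Odd (finrank ℚ ↥(normalClosure ℚ (K i₀) ℂ ⊓ normalClosure ℚ (K i₁) ℂ)) ∧ ∀ i, IsNondegenerate (Φ i) :=
  (CMAlgebra.isNondegenerateFamily_iff_forall_prod_hodgeClassSpan_eq hsep hA).symm.trans
    (isNondegenerateFamily_iff_of_twice_odd hm₀ hm₁ h01 hI h₀ h₁)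

/-- **An exceptional Hodge class on some `A₀^a × A₁^b` iff `[L₀ ∩ L₁ : ℚ]` is even or a type is degenerate** — for a
separating family of realisations of two Galois CM fields of degrees `2m₀`, `2m₁`, `m₀`, `m₁` odd.
[cite: Gordon1999HodgeAVSurvey, 7.5–7.7 and 7.6.1] [cite: Deligne1982HodgeCycles, §4] [cite: Rotman1995, Thm. 7.41] -/
theorem exists_exceptional_prod_iff_of_twice_odd {m₀ m₁ : ℕ} (hm₀ : Odd m₀) (hm₁ : Odd m₁) {i₀ i₁ : I}
    (h01 : i₀ ≠ i₁) (hI : ∀ j, j = i₀ ∨ j = i₁) [IsGalois ℚ (K i₀)] [IsGalois ℚ (K i₁)]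
    (h₀ : finrank ℚ (K i₀) = 2 * m₀) (h₁ : finrank ℚ (K i₁) = 2 * m₁) (hsep : CMAlgebra.IsSeparatingFamily Φ)
    (hA : ∀ i, IsCMTypeRealisation (Φ i) (A i) (ι i) (θ i)) :
    (∃ (N : ℕ) (π : Fin N → I) (m : ℕ) (c : complexBetti (⨁ fun j : Fin N => A (π j)).X (2 * m)),
        IsRationalClass c ∧
        IsOfHodgeType (⨁ fun j : Fin N => A (π j)).dim (⨁ fun j : Fin N => A (π j)).X (2 * m) m m c ∧
        c ∉ divisorClassesSpan (⨁ fun j : Fin N => A (π j)).X (⨁ fun j : Fin N => A (π j)).dim m) ↔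
      Even (finrank ℚ ↥(normalClosure ℚ (K i₀) ℂ ⊓ normalClosure ℚ (K i₁) ℂ)) ∨ ∃ i, ¬ IsNondegenerate (Φ i) := by
  constructor
  · rintro ⟨N, π, m, c, hcQ, hcH, hcD⟩
    by_contra h
    push Not at h
    have hnd : CMAlgebra.IsNondegenerateFamily Φ :=
      (isNondegenerateFamily_iff_of_twice_odd hm₀ hm₁ h01 hI h₀ h₁).2 ⟨Nat.not_even_iff_odd.1 h.1, h.2⟩
    exact hnd.not_exists_exceptional_prod hA π m ⟨c, hcQ, hcH, hcD⟩
  · intro h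
    refine CMAlgebra.exists_exceptional_prod_of_not_isNondegenerateFamily hsep (fun hnd => ?_) hA
    have h' := (isNondegenerateFamily_iff_of_twice_odd hm₀ hm₁ h01 hI h₀ h₁).1 hnd
    rcases h with hev | ⟨i, hi⟩
    · exact (Nat.not_even_iff_odd.2 h'.1) hev
    · exact hi (h'.2 i)

/-- **The packaged dichotomy for two simple, non-isogenous CM abelian varieties with Galois CM fields of degrees
`2m₀`, `2m₁`, `m₀`, `m₁` odd, and nondegenerate types** (e.g. primitive types in prime half-degree — Yanai): EITHER
`[L₀ ∩ L₁ : ℚ]` is odd and the Hodge conjecture holds for every `⨁_{j<N} A_{π j}` (every `A₀^a × A₁^b`) with `B• = D•`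
there, OR it is even and some such product carries a rational `(m,m)`-class outside `Dᵐ ⊗ ℂ`.
[cite: Gordon1999HodgeAVSurvey, §3 Theorem, 7.4–7.7 and 10.10] [cite: Rotman1995, Thm. 7.41] -/
theorem hodgeConjectureFor_prod_or_exists_exceptional_of_isSimple_of_twice_odd {m₀ m₁ : ℕ} (hm₀ : Odd m₀)
    (hm₁ : Odd m₁) {i₀ i₁ : I} (h01 : i₀ ≠ i₁) (hI : ∀ j, j = i₀ ∨ j = i₁) [IsGalois ℚ (K i₀)] [IsGalois ℚ (K i₁)]
    (h₀ : finrank ℚ (K i₀) = 2 * m₀) (h₁ : finrank ℚ (K i₁) = 2 * m₁) (hΦ : ∀ i, IsNondegenerate (Φ i))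
    (hA : ∀ i, IsCMTypeRealisation (Φ i) (A i) (ι i) (θ i)) (hs : ∀ i, (A i).IsSimple)
    (hniso : ∀ i j, i ≠ j → ¬ AbelianVariety.IsIsogenous (A i) (A j)) :
    (Odd (finrank ℚ ↥(normalClosure ℚ (K i₀) ℂ ⊓ normalClosure ℚ (K i₁) ℂ)) ∧
        ∀ (N : ℕ) (π : Fin N → I),
          HodgeConjectureFor (⨁ fun j : Fin N => A (π j)).dim (⨁ fun j : Fin N => A (π j)).X ∧
            ∀ m : ℕ, hodgeClassSpan (⨁ fun j : Fin N => A (π j)).dim (⨁ fun j : Fin N => A (π j)).X m =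
              divisorClassesSpan (⨁ fun j : Fin N => A (π j)).X (⨁ fun j : Fin N => A (π j)).dim m) ∨
      (Even (finrank ℚ ↥(normalClosure ℚ (K i₀) ℂ ⊓ normalClosure ℚ (K i₁) ℂ)) ∧
        ∃ (N : ℕ) (π : Fin N → I) (m : ℕ) (c : complexBetti (⨁ fun j : Fin N => A (π j)).X (2 * m)),
          IsRationalClass c ∧
          IsOfHodgeType (⨁ fun j : Fin N => A (π j)).dim (⨁ fun j : Fin N => A (π j)).X (2 * m) m m c ∧
          c ∉ divisorClassesSpan (⨁ fun j : Fin N => A (π j)).X (⨁ fun j : Fin N => A (π j)).dim m) := by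
  have hsep : CMAlgebra.IsSeparatingFamily Φ :=
    CMAlgebra.isSeparatingFamily_of_isSimple_of_pairwise_not_isIsogenous hA hs hniso
  rcases Nat.even_or_odd (finrank ℚ ↥(normalClosure ℚ (K i₀) ℂ ⊓ normalClosure ℚ (K i₁) ℂ)) with hev | hodd
  · exact Or.inr ⟨hev, exists_exceptional_prod_pair_of_twice_odd_of_even_finrank_inf hm₀ hm₁ h01 h₀ h₁ hsep hev hA⟩
  · exact Or.inl ⟨hodd, fun N π => hodgeConjectureFor_prod_pair_of_twice_odd_of_odd_finrank_inf h01 hI hodd hΦ hA π⟩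

/-- **No product of a separating pair through an EVEN `[L₀ ∩ L₁ : ℚ]` has `B• = D•` everywhere**: the partial-conjugation
criterion is sharp for Galois CM fields of degree `≡ 2 (mod 4)`. [cite: Gordon1999HodgeAVSurvey, 7.5–7.7] [cite: Rotman1995, Thm. 7.41] -/
theorem not_forall_prod_hodgeClassSpan_eq_of_twice_odd_of_even_finrank_inf {m₀ m₁ : ℕ} (hm₀ : Odd m₀)
    (hm₁ : Odd m₁) {i₀ i₁ : I} (h01 : i₀ ≠ i₁) [IsGalois ℚ (K i₀)] [IsGalois ℚ (K i₁)]
    (h₀ : finrank ℚ (K i₀) = 2 * m₀) (h₁ : finrank ℚ (K i₁) = 2 * m₁) (hsep : CMAlgebra.IsSeparatingFamily Φ)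
    (hev : Even (finrank ℚ ↥(normalClosure ℚ (K i₀) ℂ ⊓ normalClosure ℚ (K i₁) ℂ)))
    (hA : ∀ i, IsCMTypeRealisation (Φ i) (A i) (ι i) (θ i)) :
    ¬ ∀ (N : ℕ) (π : Fin N → I) (m : ℕ),
      hodgeClassSpan (⨁ fun j : Fin N => A (π j)).dim (⨁ fun j : Fin N => A (π j)).X m =
        divisorClassesSpan (⨁ fun j : Fin N => A (π j)).X (⨁ fun j : Fin N => A (π j)).dim m := fun h =>
  not_isNondegenerateFamily_of_twice_odd_of_even_finrank_inf hm₀ hm₁ h01 h₀ h₁ hev Φ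
    ((CMAlgebra.isNondegenerateFamily_iff_forall_prod_hodgeClassSpan_eq hsep hA).2 h)

end Geometry

end Summit.HodgeConjecture.CorCM

end
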